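import Literature.NumberTheory.EllipticCurves.FunctionFieldMordellWeilProofs
import Literature.NumberTheory.EllipticCurves.FunctionFieldShaTateModuleProofs
import HarnessLib

/-!
# Mordell–Weil–Lang–Néron facts of `FunctionFieldEllipticL`: discharges

Sibling proof file of `Literature.NumberTheory.EllipticCurves.FunctionFieldEllipticL` (D-0014: the
facts there are named `def X : Prop`; discharges live in sibling files). It **discharges** five
named facts of its section `FunctionField` — `module_finite_point`, `finite_torsion`,
`exists_isMordellWeilBasis`, `torsionOrder_pos` (Lang–Néron: `E(F)` finitely generated, finite
torsion, a Mordell–Weil basis, `#E(F)_tors ≥ 1`; Lang–Néron (1959) Thm. 1; Ulmer (2011),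
Lecture 1, Thm. 5.1 and §6) and `finite_sha_torsionBy` (`Ш(E/F)[n]` finite for `n` invertible in
`F`; Milne, *ADT*, I.6.6–6.7; Ulmer (2011), Lecture 1, §11) — as one-line wrappers around theorems
already PROVED in the tree: `module_finite_point_of_functionField`,
`finite_torsion_of_functionField`, `exists_isMordellWeilBasis_of_functionField`
(`FunctionFieldMordellWeilProofs`: the descent theorem AEC VIII.3.1 with the naive height, its
approximate parallelogram law, Northcott, and weak Mordell–Weil over `F`) and `finite_torsionBy_sha`
(`FunctionFieldShaTateModuleProofs`: `Ш[n] ↪ Ш[p'][n]`, finite by Milne ADT I.6.7). No new fact,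
no statement change, no hypothesis on `W` beyond the facts' own `[W.IsElliptic]` binder.

## Binders of the facts and of their discharges (cell record C176)

The five `def`s elaborate with the binders `{F : Type} [Field F] (W : WeierstrassCurve F)` only:
the `include Fq` of their section does not reach `def`s (statement file, "Corrected statements"),
although every docstring and citation scopes them to an elliptic curve over a GLOBAL FUNCTION
FIELD `F / 𝔽_q(T)` (Lang–Néron; Ulmer, Lecture 1). `FunctionFieldMordellWeilProofs` therefore
proved the corrected forms under the names `…_of_functionField` and filed no `_holds`. The
discharges below state the facts under the section's global-function-field instance stack
`(Fq : Type) [Field Fq] [Fintype Fq] [Algebra Fq[X] F] [Algebra (RatFunc Fq) F]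
[IsScalarTower Fq[X] (RatFunc Fq) F] [FunctionField Fq F]` VERBATIM — the standing hypothesis of
every cited source and the variables under which every consumer of these facts lives — exactly as
the accepted sibling discharges `Place.finite_residueField_holds`,
`twelve_dvd_degMinimalDiscriminant_holds`, `regulatorOf_eq_regulator_holds`, `regulator_pos_holds`,
`finite_setOf_ordMinimalDiscriminant_ne_zero_holds`, `tamagawaProduct_pos_holds` do; no `Prop`
hypothesis is added. This is the convention recorded by the cell's literature lead (CITED-FACTS
C176: binders = the section's structure binders verbatim; the defs' docstrings already restrict to
global function fields; the discharge says why the structure appears as binders — this paragraph).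

## References

* [LangNeron1959AJM] S. Lang, A. Néron, *Rational points of abelian varieties over function
  fields*, Amer. J. Math. 81 (1959), 95–118, Thm. 1.
* [Ulmer2011ParkCity] D. Ulmer, *Elliptic curves over function fields*, IAS/Park City Math.
  Ser. 18 (2011), Lecture 1, Thm. 5.1, §6, §11 (arXiv:1101.1939).
* [MilneADT2006] J. S. Milne, *Arithmetic Duality Theorems*, 2nd ed. (2006), I.§6, 6.6–6.7.
* [SilvermanAEC2009] J. H. Silverman, *The Arithmetic of Elliptic Curves*, 2nd ed., GTM 106
  (2009), Thm. VIII.3.1, VIII.6.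
-/

noncomputable section

open scoped Polynomial

namespace Literature.NumberTheory.EllipticCurves.FunctionField

variable {F : Type} [Field F]
variable (Fq : Type) [Field Fq] [Fintype Fq]
variable [Algebra Fq[X] F] [Algebra (RatFunc Fq) F] [IsScalarTower Fq[X] (RatFunc Fq) F]
variable [FunctionField Fq F]
variable (W : WeierstrassCurve F)

include Fq

/-- **Lang–Néron**: `E(F)` is a finite `ℤ`-module for an elliptic curve over the global function
field `F / 𝔽_q(T)` — discharge of the named fact `module_finite_point` (wrapper around
`module_finite_point_of_functionField`). [cite: Ulmer2011ParkCity, Lecture 1, Thm. 5.1]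
[cite: LangNeron1959AJM, Thm. 1] -/
theorem module_finite_point_holds : module_finite_point W := by
  intro _
  exact module_finite_point_of_functionField W Fq

/-- `E(F)_tors` is finite over a global function field — discharge of the named fact
`finite_torsion` (wrapper around `finite_torsion_of_functionField`).
[cite: Ulmer2011ParkCity, Lecture 1, Thm. 5.1] -/
theorem finite_torsion_holds : finite_torsion W := by
  intro _
  exact finite_torsion_of_functionField W Fq

/-- `E(F)` has a Mordell–Weil basis over a global function field — discharge of the named fact
`exists_isMordellWeilBasis` (wrapper around `exists_isMordellWeilBasis_of_functionField`).
[cite: Ulmer2011ParkCity, Lecture 1, Thm. 5.1] -/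
theorem exists_isMordellWeilBasis_holds : exists_isMordellWeilBasis W := by
  intro _
  exact exists_isMordellWeilBasis_of_functionField W Fq

/-- `#E(F)_tors ≥ 1` over a global function field — discharge of the named fact `torsionOrder_pos`
(the statement file's preserved interim proof: `Nat.card` of a finite nonempty type is positive,
with `finite_torsion_of_functionField`). [cite: Ulmer2011ParkCity, Lecture 1, §6] -/
theorem torsionOrder_pos_holds : torsionOrder_pos W := by
  intro _
  haveI := finite_torsion_of_functionField W Fq
  exact Nat.card_pos

/-- `Ш(E/F)[n]` is finite for `n` invertible in `F`, over a global function field — discharge of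
the named fact `finite_sha_torsionBy` (wrapper around `finite_torsionBy_sha`: for `n : ℤ`,
`Ш[n] = Ш[|n|]`). [cite: MilneADT2006, I.§6 Remark 6.7] [cite: Ulmer2011ParkCity, Lecture 1, §11] -/
theorem finite_sha_torsionBy_holds : finite_sha_torsionBy W := by
  intro _ n hn
  obtain ⟨m, rfl | rfl⟩ : ∃ m : ℕ, n = m ∨ n = -m := ⟨_, Int.natAbs_eq n⟩
  · exact finite_torsionBy_sha W Fq (n := m) (by exact_mod_cast hn)
  · rw [AddSubgroup.torsionBy.neg]
    rw [Int.cast_neg, neg_ne_zero] at hn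
    exact finite_torsionBy_sha W Fq (n := m) (by exact_mod_cast hn)

end Literature.NumberTheory.EllipticCurves.FunctionField

end
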